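import Summits.AnomalousDissipation.AnomalousDissipation.Theorems.SawtoothPulseCascadeK1LocalisedCascadeCornerTraceShift
import Summits.AnomalousDissipation.AnomalousDissipation.Theorems.SawtoothPulseCascadeK1LocalisedCascadeChirpRounding
import Summits.AnomalousDissipation.AnomalousDissipation.Theorems.SawtoothPulseCascadeK1LocalisedCascadeTraceEnergy
import Summits.AnomalousDissipation.AnomalousDissipation.Theorems.SawtoothPulseCascadeK1LocalisedCascadeTraceKernels

/-!
# K1loc, line `Spectral` / thin start — helper: THE ROUNDED CHIRP IN A CORNER-TRACE WINDOW («CornerTraceRounding»)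

Helper file of the prover lane on the crux `K1LocalisedCascade` (stmt-AnomalousDissipation-19491), route `SawtoothPulseCascade`
(glue seat; arbiter A23-13: the CT dischargers).  `…CornerTraceSum.cornerTrace_sum_sq_le` bounds the window energy
`Σ_{k∈W}|Σ_{l∈S} c_l ĝ₀(k−l)|²` for the EXACT `N`-tooth chirp `g₀`; the cascade's chirp is `g = twist ψ n` with the ROUNDED profile,
uniformly close to the exact one (`…ChirpRounding.abs_U_sub_exactProfile_le`).  Since `Σ_l c_l ĝ(k−l) = 𝓕(g·T)(k)` for the
trigonometric polynomial `T = Σ_{l∈S} c_l e_l` (`…CornerTraceShift`), the difference is `𝓕((g−g₀)·T)`, whose `ℓ²` norm over ANY window is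
at most `‖(g−g₀)T‖₂ ≤ ‖g−g₀‖_∞‖T‖₂ = ‖g−g₀‖_∞ (Σ_l|c_l|²)^{1/2}` (Bessel + finite Parseval):
* `sum_sq_norm_fourierCoeff_le_integral_sq`: Bessel with the `L²` norm, `Σ_{q∈S}|ĥ(q)|² ≤ ∫|h|²`;
* **`sqrt_window_sq_le_of_near`**: `‖g − g₀‖ ≤ ε` pointwise ⇒
  `√(Σ_{k∈W}|Σ_l c_l ĝ(k−l)|²) ≤ √(Σ_{k∈W}|Σ_l c_l ĝ₀(k−l)|²) + ε·√(Σ_{l∈S}|c_l|²)` — so every exact-chirp window bound transfers to the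
  rounded chirp at the cost `ε‖c‖₂`, no zones;
* `sqrt_window_sq_twist_le`: the same for `g = twist ψ n` against `g₀ = e^{−2πi f}` under `|nψ − f| ≤ η` (`ε = 2πη`), e.g.
  `f = L₂·tri(2πNt)/(2πN)` as in `cornerTrace_sum_sq_le`.
No definitions; nothing about the crux. [cite: Grafakos2014, Prop. 3.1.2 (5), Prop. 3.2.7 (3)] [problem: turb]
-/

-- `Summit.<Summit>.<Problem>`: single-conjunct summit, the duplicate namespace segment is deliberate.
set_option linter.dupNamespace false

noncomputable section

namespace Summit.AnomalousDissipation.AnomalousDissipation.Theorems.SawtoothPulseCascade.K1Window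

open MeasureTheory Complex AddCircle
open scoped Real
open Literature.Analysis.FunctionSpaces Literature.Analysis.FunctionSpaces.Torus
open Summit.AnomalousDissipation.AnomalousDissipation.Theorems.SawtoothPulseCascade.K1Start

/-! ## §1 Bessel with the `L²` norm; the `L²` norm of a trigonometric polynomial -/

/-- **Bessel on the circle, `L²` form**: for continuous `h` and every finite `S`, `Σ_{q∈S} ‖ĥ(q)‖² ≤ ∫ ‖h‖² dμ_Haar`.
[cite: Grafakos2014, Prop. 3.2.7 (3)] -/
theorem sum_sq_norm_fourierCoeff_le_integral_sq {h : UnitAddCircle → ℂ} (hc : Continuous h) (S : Finset ℤ) :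
    ∑ q ∈ S, ‖fourierCoeff h q‖ ^ 2 ≤ ∫ t, ‖h t‖ ^ 2 ∂haarAddCircle := by
  have hmem : MemLp h 2 haarAddCircle :=
    hc.memLp_of_hasCompactSupport (HasCompactSupport.of_compactSpace _)
  have hP := hasSum_sq_fourierCoeff (hmem.toLp _)
  have hcoe : ∀ p, fourierCoeff (hmem.toLp _) p = fourierCoeff h p := by
    intro p
    simp only [fourierCoeff]
    exact integral_congr_ae (by filter_upwards [MemLp.coeFn_toLp hmem] with x hx; simp only [hx])
  simp_rw [hcoe] at hP
  have h1 : ∫ t, ‖(hmem.toLp _) t‖ ^ 2 ∂haarAddCircle = ∫ t, ‖h t‖ ^ 2 ∂haarAddCircle :=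
    integral_congr_ae (by filter_upwards [MemLp.coeFn_toLp hmem] with t ht; rw [ht])
  rw [← h1]
  exact sum_le_hasSum S (fun q _ => sq_nonneg _) hP

/-- **`L²` norm of a trigonometric polynomial** (Haar form): `∫ |Σ_{l∈S} c_l e_l|² dμ_Haar = Σ_{l∈S} |c_l|²`.
[cite: Grafakos2014, Prop. 3.2.7 (3)] -/
theorem integral_haar_norm_sq_trigPoly_eq (S : Finset ℤ) (c : ℤ → ℂ) :
    ∫ t : UnitAddCircle, ‖∑ l ∈ S, c l * fourier l t‖ ^ 2 ∂haarAddCircle = ∑ l ∈ S, ‖c l‖ ^ 2 := by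
  classical
  -- reindex `l ↦ −l` to the `e_{−n}` convention of `integral_norm_sq_trigSum_eq`
  have hinj : Function.Injective (fun l : ℤ => -l) := fun a b h => by simpa using h
  have e1 : ∀ t : UnitAddCircle, ∑ l ∈ S, c l * fourier l t = ∑ n ∈ S.image (fun l : ℤ => -l), c (-n) * fourier (-n) t := by
    intro t
    rw [Finset.sum_image fun a _ b _ h => hinj h]
    simp
  have e2 : ∑ l ∈ S, ‖c l‖ ^ 2 = ∑ n ∈ S.image (fun l : ℤ => -l), ‖c (-n)‖ ^ 2 := by
    rw [Finset.sum_image fun a _ b _ h => hinj h]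
    simp
  have hv : (volume : Measure UnitAddCircle) = haarAddCircle := by
    rw [AddCircle.volume_eq_smul_haarAddCircle]; simp
  simp_rw [e1]
  rw [e2, ← hv]
  exact integral_norm_sq_trigSum_eq (S.image (fun l : ℤ => -l)) (fun n => c (-n))

/-! ## §2 The window bound transfers from the exact to the rounded chirp -/

/-- **`ℓ²` triangle inequality on a window**: `√(Σ_{k∈W}|a_k|²) ≤ √(Σ_{k∈W}|b_k|²) + √(Σ_{k∈W}|a_k − b_k|²)`. [folklore] -/
theorem sqrt_sum_sq_le_sqrt_add_sqrt (W : Finset ℤ) (a b : ℤ → ℂ) :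
    Real.sqrt (∑ k ∈ W, ‖a k‖ ^ 2) ≤ Real.sqrt (∑ k ∈ W, ‖b k‖ ^ 2) + Real.sqrt (∑ k ∈ W, ‖a k - b k‖ ^ 2) := by
  classical
  -- Minkowski with the two summands `b` and `a − b`
  set u : ℤ → ℤ → ℂ := fun i k => if i = 0 then b k else a k - b k with hu
  have h := sq_sum_norm_sum_le ({0, 1} : Finset ℤ) W u
  have h01 : (0 : ℤ) ∉ ({1} : Finset ℤ) := by simp
  rw [Finset.sum_insert h01, Finset.sum_singleton] at h
  have e : ∀ k, ∑ i ∈ ({0, 1} : Finset ℤ), u i k = a k := by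
    intro k
    rw [Finset.sum_insert h01, Finset.sum_singleton]
    simp [hu]
  simp_rw [e] at h
  have e0 : (fun k => ‖u 0 k‖ ^ 2) = fun k => ‖b k‖ ^ 2 := by funext k; simp [hu]
  have e1 : (fun k => ‖u 1 k‖ ^ 2) = fun k => ‖a k - b k‖ ^ 2 := by funext k; simp [hu]
  simp only [e0, e1] at h
  have h0 : 0 ≤ Real.sqrt (∑ k ∈ W, ‖b k‖ ^ 2) + Real.sqrt (∑ k ∈ W, ‖a k - b k‖ ^ 2) := by positivity
  calc Real.sqrt (∑ k ∈ W, ‖a k‖ ^ 2)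
      ≤ Real.sqrt ((Real.sqrt (∑ k ∈ W, ‖b k‖ ^ 2) + Real.sqrt (∑ k ∈ W, ‖a k - b k‖ ^ 2)) ^ 2) :=
        Real.sqrt_le_sqrt h
    _ = _ := Real.sqrt_sq h0

set_option maxHeartbeats 400000 in
/-- **THE ROUNDED CHIRP IN A WINDOW**: for continuous `g, g₀` with `‖g x − g₀ x‖ ≤ ε` everywhere, coefficients `c` on a finite `S`
and any finite window `W`,
`√(Σ_{k∈W}|Σ_{l∈S} c_l ĝ(k−l)|²) ≤ √(Σ_{k∈W}|Σ_{l∈S} c_l ĝ₀(k−l)|²) + ε·√(Σ_{l∈S}|c_l|²)`. [cite: Grafakos2014, Prop. 3.1.2 (5), Prop. 3.2.7 (3)] -/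
theorem sqrt_window_sq_le_of_near {g g₀ : UnitAddCircle → ℂ} (hg : Continuous g) (hg₀ : Continuous g₀) {ε : ℝ}
    (hε : ∀ x, ‖g x - g₀ x‖ ≤ ε) (c : ℤ → ℂ) (S W : Finset ℤ) :
    Real.sqrt (∑ k ∈ W, ‖∑ l ∈ S, c l * fourierCoeff g (k - l)‖ ^ 2) ≤
      Real.sqrt (∑ k ∈ W, ‖∑ l ∈ S, c l * fourierCoeff g₀ (k - l)‖ ^ 2) + ε * Real.sqrt (∑ l ∈ S, ‖c l‖ ^ 2) := by
  have hε0 : 0 ≤ ε := (norm_nonneg _).trans (hε 0)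
  set T : UnitAddCircle → ℂ := fun x => ∑ l ∈ S, c l * fourier l x with hT
  have hTc : Continuous T := by
    refine continuous_finsetSum _ fun l _ => continuous_const.mul (fourier l).continuous
  set h : UnitAddCircle → ℂ := fun x => (g x - g₀ x) * T x with hh
  have hhc : Continuous h := (hg.sub hg₀).mul hTc
  -- the difference of the two convolutions is the coefficient of `(g − g₀)·T`
  have hdiff : ∀ k, ∑ l ∈ S, c l * fourierCoeff g (k - l) - ∑ l ∈ S, c l * fourierCoeff g₀ (k - l) = fourierCoeff h k := by
    intro k
    rw [← fourierCoeff_mul_trigPoly hg c S k, ← fourierCoeff_mul_trigPoly hg₀ c S k]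
    have hI1 : Integrable (fun x : UnitAddCircle => (fourier (-k) x : ℂ) • (g x * ∑ l ∈ S, c l * fourier l x)) haarAddCircle :=
      ((fourier (-k)).continuous.smul (hg.mul hTc)).integrable_of_hasCompactSupport (HasCompactSupport.of_compactSpace _)
    have hI2 : Integrable (fun x : UnitAddCircle => (fourier (-k) x : ℂ) • (g₀ x * ∑ l ∈ S, c l * fourier l x)) haarAddCircle :=
      ((fourier (-k)).continuous.smul (hg₀.mul hTc)).integrable_of_hasCompactSupport (HasCompactSupport.of_compactSpace _)
    simp only [fourierCoeff]
    rw [← integral_sub hI1 hI2]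
    refine integral_congr_ae (Filter.Eventually.of_forall fun x => ?_)
    simp only [hh, hT, smul_eq_mul]
    ring
  -- Bessel + the pointwise bound
  have hB : ∑ k ∈ W, ‖fourierCoeff h k‖ ^ 2 ≤ ε ^ 2 * ∑ l ∈ S, ‖c l‖ ^ 2 := by
    refine (sum_sq_norm_fourierCoeff_le_integral_sq hhc W).trans ?_
    rw [← integral_haar_norm_sq_trigPoly_eq S c, ← integral_const_mul]
    refine integral_mono_of_nonneg (Filter.Eventually.of_forall fun t => sq_nonneg _)
      (((hTc.norm.pow 2).const_mul _).integrable_of_hasCompactSupport (HasCompactSupport.of_compactSpace _))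
      (Filter.Eventually.of_forall fun t => ?_)
    dsimp only
    rw [hh, norm_mul, mul_pow]
    exact mul_le_mul_of_nonneg_right (pow_le_pow_left₀ (norm_nonneg _) (hε t) 2) (sq_nonneg _)
  have hsq : Real.sqrt (∑ k ∈ W, ‖fourierCoeff h k‖ ^ 2) ≤ ε * Real.sqrt (∑ l ∈ S, ‖c l‖ ^ 2) := by
    rw [show ε * Real.sqrt (∑ l ∈ S, ‖c l‖ ^ 2) = Real.sqrt (ε ^ 2 * ∑ l ∈ S, ‖c l‖ ^ 2) by
      rw [Real.sqrt_mul (sq_nonneg _), Real.sqrt_sq hε0]]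
    exact Real.sqrt_le_sqrt hB
  have htri := sqrt_sum_sq_le_sqrt_add_sqrt W (fun k => ∑ l ∈ S, c l * fourierCoeff g (k - l))
    (fun k => ∑ l ∈ S, c l * fourierCoeff g₀ (k - l))
  simp only [hdiff] at htri
  exact htri.trans (by linarith)

/-- **The cascade's chirp against an exact phase**: if `g₀(t) = e^{−2πi f(t)}` (continuous on the circle) and `|n·ψ(t) − f(t)| ≤ η`
for all real `t`, then for all `c, S, W`:
`√(Σ_{k∈W}|Σ_l c_l 𝓕(twist ψ n)(k−l)|²) ≤ √(Σ_{k∈W}|Σ_l c_l ĝ₀(k−l)|²) + 2πη·√(Σ_l|c_l|²)`. [cite: Grafakos2014, Prop. 3.2.7 (3)] -/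
theorem sqrt_window_sq_twist_le (ψ : ShearProfile) (n : ℤ) {f : ℝ → ℝ} {g₀ : UnitAddCircle → ℂ}
    (hg₀ : ∀ t : ℝ, g₀ (t : UnitAddCircle) = cexp (-(2 * π * I * ((f t : ℝ) : ℂ)))) (hg₀c : Continuous g₀) {η : ℝ}
    (hη : ∀ t : ℝ, |n * ψ t - f t| ≤ η) (c : ℤ → ℂ) (S W : Finset ℤ) :
    Real.sqrt (∑ k ∈ W, ‖∑ l ∈ S, c l * fourierCoeff (twist ψ n) (k - l)‖ ^ 2) ≤
      Real.sqrt (∑ k ∈ W, ‖∑ l ∈ S, c l * fourierCoeff g₀ (k - l)‖ ^ 2) + 2 * π * η * Real.sqrt (∑ l ∈ S, ‖c l‖ ^ 2) := by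
  refine sqrt_window_sq_le_of_near (continuous_twist ψ n) hg₀c (fun x => ?_) c S W
  obtain ⟨t, rfl⟩ := QuotientAddGroup.mk_surjective x
  rw [twist_coe, hg₀ t]
  have h := norm_exp_neg_two_pi_I_sub_le (n * ψ t) (f t)
  have e1 : cexp (-(2 * π * I * ((n * ψ t : ℝ) : ℂ))) = cexp (-(2 * Real.pi * Complex.I * n * ψ t)) := by
    congr 1; push_cast; ring
  rw [e1] at h
  exact h.trans (by nlinarith [hη t, Real.pi_pos, abs_nonneg (n * ψ t - f t)])

end Summit.AnomalousDissipation.AnomalousDissipation.Theorems.SawtoothPulseCascade.K1Window
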